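import Summits.ResolutionOfSingularities.ResolutionOfSingularities.Theorems.FrobeniusClosingPatchingRelPerfectMonomialPolyhedraGameMarked
import Mathlib.Data.Finsupp.Basic
import Mathlib.Logic.Equiv.Basic
import HarnessLib

/-!
# Crux `PatchingRelPerfect` (stmt-ResolutionOfSingularities-16161), chain w52 — TargetsF3 (m)
# «M2-strong», COMBINATORIAL HALF, Route K step K6: RELABELLING invariance of the marked game and
# the REDUCTION of `RouteKTarget m` to SIMPLEX states (`Str = 𝒫(B)`)

[OURS · L1 W5.2 · res-L1-w52-plan-1 RULING «Route K approved» 07:37:28Z; design memo v3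
(`L/res-type-075/M2STRONG-COMBINATORIAL-HALF.md`); fact-free; nothing here is a statement of the
manuscript under review]

Route K reads a winning play for the marking-`m` game off the tree's functorial order reduction on a
TORIC model of the state.  The model of a SIMPLEX state (every subset of the boundary indices is a
stratum) is the affine space `𝔸^B_ℚ` itself, and all charts of the blow-up tower are then affine
spaces with the same set of variables (tree `CoordinateBlowupChart.lean`).  This file reduces the
target to that case, purely combinatorially:

* `State.relabel σ s` — renaming the boundary indices along a permutation `σ` of `ℕ`;
  `WinnableAll.relabel` — all-names winnability is invariant under renaming (the definition
  quantifies over every fresh name, so a renamed play is again a play).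
* `Sub s ŝ` — `ŝ` DOMINATES `s`: same exponent vectors on the indices of `s` (through a map of
  vectors), more indices, more strata.  `WinnableAll.of_sub` — **a win from the dominating state
  restricts to a win from `s`**: moves of `ŝ` at strata of `s` are replayed (they stay permissible,
  weights being read on indices of `s`), moves at strata NOT in `s` are skipped (they do not change
  the restricted state), and a fresh name already used by `ŝ` is handled by `WinnableAll.relabel`.
* `State.simplex s` (`Str := 𝒫(B)`), `Sub.simplex`, and
  **`routeKTarget_of_simplex : (∀ s, s.WF → s.Str = s.B.powerset → WinnableAll m s) → RouteKTarget m`**.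
-/

-- `Summit.<Summit>.<Sub>.Theorems` with `Sub = Summit` (single-conjunct summit, D-0017)
set_option linter.dupNamespace false

namespace Summit.ResolutionOfSingularities.ResolutionOfSingularities.Theorems

namespace PolyhedraGame

open Finset

/-! ## Relabelling along a permutation of `ℕ` -/

/-- [OURS · W5.2 M2-strong] Rename the boundary indices of a state along a permutation `σ` of `ℕ`
(strata and exponent vectors are carried along). -/
noncomputable def State.relabel (σ : Equiv.Perm ℕ) (s : State) : State where
  B := s.B.image σ
  Str := s.Str.image fun T => T.image σ
  A := s.A.image (Finsupp.mapDomain σ)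

/-- [OURS] Weights are invariant under renaming. -/
theorem weight_relabel (σ : Equiv.Perm ℕ) (J : Finset ℕ) (α : ℕ →₀ ℕ) :
    weight (J.image σ) (Finsupp.mapDomain σ α) = weight J α := by
  unfold weight
  rw [Finset.sum_image fun x _ y _ h => σ.injective h]
  exact Finset.sum_congr rfl fun j _ => Finsupp.mapDomain_apply σ.injective α j

/-- [OURS] The transform of an exponent vector commutes with renaming. -/
theorem mapDomain_moveExp (σ : Equiv.Perm ℕ) (J : Finset ℕ) (e c : ℕ) (α : ℕ →₀ ℕ) :
    Finsupp.mapDomain σ (moveExp J e c α) = moveExp (J.image σ) (σ e) c (Finsupp.mapDomain σ α) := by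
  unfold moveExp
  rw [Finsupp.mapDomain_add, Finsupp.mapDomain_single, weight_relabel]

/-- [OURS] `J ⊆ T` is invariant under renaming. -/
theorem image_subset_image_iff_of_perm (σ : Equiv.Perm ℕ) {J T : Finset ℕ} :
    J.image σ ⊆ T.image σ ↔ J ⊆ T :=
  Finset.image_subset_image_iff σ.injective

/-- [OURS] The star subdivision commutes with renaming. -/
theorem moveStrata_relabel (σ : Equiv.Perm ℕ) (Str : Finset (Finset ℕ)) (J : Finset ℕ) (e : ℕ) :
    (moveStrata Str J e).image (fun T => T.image σ) =
      moveStrata (Str.image fun T => T.image σ) (J.image σ) (σ e) := by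
  ext T'
  simp only [Finset.mem_image, mem_moveStrata_iff]
  constructor
  · rintro ⟨T, hT, rfl⟩
    rcases hT with ⟨hT, hJT⟩ | ⟨T₀, hT₀, hJT₀, hTJ, rfl⟩
    · exact Or.inl ⟨⟨T, hT, rfl⟩, fun h => hJT ((image_subset_image_iff_of_perm σ).mp h)⟩
    · refine Or.inr ⟨T₀.image σ, ⟨T₀, hT₀, rfl⟩, fun h => hJT₀ ((image_subset_image_iff_of_perm σ).mp h),
        ⟨T₀ ∪ J, hTJ, Finset.image_union _ _⟩, ?_⟩
      rw [Finset.image_insert]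
  · rintro (⟨⟨T, hT, rfl⟩, hJT⟩ | ⟨_, ⟨T₀, hT₀, rfl⟩, hJT₀, ⟨T₁, hT₁, hT₁eq⟩, rfl⟩)
    · exact ⟨T, Or.inl ⟨hT, fun h => hJT ((image_subset_image_iff_of_perm σ).mpr h)⟩, rfl⟩
    · have hT₁' : T₁ = T₀ ∪ J := by
        apply Finset.image_injective σ.injective
        rw [hT₁eq, Finset.image_union]
      subst hT₁'
      refine ⟨insert e T₀, Or.inr ⟨T₀, hT₀, fun h => hJT₀ ((image_subset_image_iff_of_perm σ).mpr h),
        hT₁, rfl⟩, ?_⟩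
      rw [Finset.image_insert]

/-- [OURS] A move commutes with renaming. -/
theorem relabel_move (σ : Equiv.Perm ℕ) (s : State) (J : Finset ℕ) (e c : ℕ) :
    (move s J e c).relabel σ = move (s.relabel σ) (J.image σ) (σ e) c := by
  simp only [State.relabel, move, Finset.image_insert, moveStrata_relabel, Finset.image_image]
  congr 1
  exact Finset.image_congr fun α _ => mapDomain_moveExp σ J e c α

/-- [OURS] The local win is invariant under renaming. -/
theorem WonM.relabel (σ : Equiv.Perm ℕ) {m : ℕ} {s : State} (h : WonM m s) : WonM m (s.relabel σ) := by
  intro T' hT'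
  obtain ⟨T, hT, rfl⟩ := Finset.mem_image.mp hT'
  obtain ⟨α, hα, hlt⟩ := h T hT
  exact ⟨Finsupp.mapDomain σ α, Finset.mem_image_of_mem _ hα, by rwa [weight_relabel]⟩

/-- [OURS] Permissibility is invariant under renaming. -/
theorem PermissibleM.relabel (σ : Equiv.Perm ℕ) {m : ℕ} {s : State} {J : Finset ℕ}
    (h : PermissibleM m s J) : PermissibleM m (s.relabel σ) (J.image σ) := by
  refine ⟨Finset.mem_image_of_mem _ h.1, h.2.1.image _, fun β hβ => ?_⟩
  obtain ⟨α, hα, rfl⟩ := Finset.mem_image.mp hβ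
  rw [weight_relabel]
  exact h.2.2 α hα

/-- [OURS · W5.2 M2-strong] **All-names winnability is invariant under renaming the indices.** -/
theorem WinnableAll.relabel {m : ℕ} {s : State} (h : WinnableAll m s) (σ : Equiv.Perm ℕ) :
    WinnableAll m (s.relabel σ) := by
  induction h with
  | done hw => exact WinnableAll.done (hw.relabel σ)
  | step J hJ _ ih =>
    refine WinnableAll.step (J.image σ) (hJ.relabel σ) fun e' he' => ?_
    have he : σ.symm e' ∉ _ := fun h => he' (by
      obtain h' := Finset.mem_image_of_mem σ h
      rwa [Equiv.apply_symm_apply] at h')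
    have := ih (σ.symm e') he
    rwa [relabel_move, Equiv.apply_symm_apply] at this

/-- [OURS] A renaming fixing the live indices of a well-formed state fixes the state. -/
theorem relabel_eq_self_of_forall {s : State} (hs : s.WF) (σ : Equiv.Perm ℕ)
    (hσ : ∀ b ∈ s.B, σ b = b) : s.relabel σ = s := by
  have hB : ∀ T : Finset ℕ, T ⊆ s.B → T.image σ = T := fun T hT => by
    rw [Finset.image_congr (g := id) fun b hb => hσ b (hT hb), Finset.image_id]
  have hA : ∀ α ∈ s.A, Finsupp.mapDomain σ α = α := fun α hα => by
    ext b
    rw [Finsupp.mapDomain_equiv_apply]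
    by_cases hb : σ.symm b ∈ s.B
    · have h1 : σ (σ.symm b) = σ.symm b := hσ _ hb
      rw [Equiv.apply_symm_apply] at h1
      rw [← h1]
    · have h0 : α (σ.symm b) = 0 :=
        Finsupp.notMem_support_iff.mp fun h => hb (hs.support_subset α hα h)
      have hb' : b ∉ s.B := fun h => hb (by
        have h1 : σ b = b := hσ b h
        have h2 : σ.symm b = b := by
          conv_lhs => rw [← h1]
          exact Equiv.symm_apply_apply σ b
        rwa [h2])
      have h0' : α b = 0 := Finsupp.notMem_support_iff.mp fun h => hb' (hs.support_subset α hα h)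
      rw [h0, h0']
  cases s with
  | mk B Str A =>
    simp only [State.relabel, State.mk.injEq]
    refine ⟨hB B subset_rfl, ?_, ?_⟩
    · rw [Finset.image_congr (g := id) fun T hT => hB T (hs.str_subset T (Finset.mem_coe.mp hT)),
        Finset.image_id]
    · rw [Finset.image_congr (g := id) fun α hα => hA α (Finset.mem_coe.mp hα), Finset.image_id]

/-! ## Domination and the restriction of a win -/

/-- [OURS · W5.2 M2-strong] `Sub s ŝ`: the state `ŝ` DOMINATES `s` — it has all the indices and
strata of `s`, and its exponent vectors are those of `s` carried by a map `φ` which does not change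
the exponents at indices of `s` (it may add exponents at the extra indices). -/
structure Sub (s ŝ : State) : Prop where
  /-- more indices -/
  B_subset : s.B ⊆ ŝ.B
  /-- more strata -/
  str_subset : s.Str ⊆ ŝ.Str
  /-- the same vectors on the indices of `s` -/
  exists_map : ∃ φ : (ℕ →₀ ℕ) → (ℕ →₀ ℕ), ŝ.A = s.A.image φ ∧ ∀ α ∈ s.A, ∀ b ∈ s.B, φ α b = α b

/-- [OURS] Domination is reflexive on the strata: enlarging `Str` dominates. -/
theorem Sub.of_str_subset {s : State} {Str' : Finset (Finset ℕ)} (h : s.Str ⊆ Str') :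
    Sub s { s with Str := Str' } :=
  ⟨subset_rfl, h, ⟨id, by simp, fun _ _ _ _ => rfl⟩⟩

/-- [OURS] A local win of the dominating state is a local win. -/
theorem WonM.of_sub {m : ℕ} {s ŝ : State} (hs : s.WF) (hsub : Sub s ŝ) (h : WonM m ŝ) : WonM m s := by
  obtain ⟨φ, hA, hφ⟩ := hsub.exists_map
  intro T hT
  obtain ⟨β, hβ, hlt⟩ := h T (hsub.str_subset hT)
  rw [hA] at hβ
  obtain ⟨α, hα, rfl⟩ := Finset.mem_image.mp hβ
  refine ⟨α, hα, ?_⟩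
  have : weight T (φ α) = weight T α :=
    Finset.sum_congr rfl fun b hb => hφ α hα b (hs.str_subset T hT hb)
  rwa [this] at hlt

/-- [OURS] A permissible centre of the dominating state which is a stratum of `s` is permissible
for `s`. -/
theorem PermissibleM.of_sub {m : ℕ} {s ŝ : State} (hs : s.WF) (hsub : Sub s ŝ) {J : Finset ℕ}
    (hJ : J ∈ s.Str) (h : PermissibleM m ŝ J) : PermissibleM m s J := by
  obtain ⟨φ, hA, hφ⟩ := hsub.exists_map
  refine ⟨hJ, h.2.1, fun α hα => ?_⟩
  have hmem : φ α ∈ ŝ.A := by rw [hA]; exact Finset.mem_image_of_mem _ hα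
  have hw : weight J (φ α) = weight J α :=
    Finset.sum_congr rfl fun b hb => hφ α hα b (hs.str_subset J hJ hb)
  rw [← hw]
  exact h.2.2 _ hmem

/-- [OURS] Domination persists when BOTH states blow up a stratum of `s` with the same fresh name. -/
theorem Sub.move_both {s ŝ : State} (hs : s.WF) (hŝ : ŝ.WF) (hsub : Sub s ŝ) {J : Finset ℕ}
    (hJ : J ∈ s.Str) {e : ℕ} (he : e ∉ ŝ.B) (c : ℕ) : Sub (move s J e c) (move ŝ J e c) := by
  obtain ⟨φ, hA, hφ⟩ := hsub.exists_map
  have hJB : J ⊆ s.B := hs.str_subset J hJ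
  refine ⟨Finset.insert_subset_insert _ hsub.B_subset, ?_, ?_⟩
  · intro T hT
    rcases mem_moveStrata_iff.mp hT with ⟨hT₀, hJT⟩ | ⟨T₀, hT₀, hJT₀, hTJ, rfl⟩
    · exact mem_moveStrata_iff.mpr (Or.inl ⟨hsub.str_subset hT₀, hJT⟩)
    · exact mem_moveStrata_iff.mpr (Or.inr ⟨T₀, hsub.str_subset hT₀, hJT₀, hsub.str_subset hTJ, rfl⟩)
  · refine ⟨fun β => φ (β.erase e) + Finsupp.single e (β e), ?_, ?_⟩
    · change (ŝ.A.image (moveExp J e c)) = (s.A.image (moveExp J e c)).image _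
      rw [hA, Finset.image_image, Finset.image_image]
      apply Finset.image_congr
      intro α hα
      have hαe : α e = 0 :=
        Finsupp.notMem_support_iff.mp fun h => he (hsub.B_subset (hs.support_subset α hα h))
      have hφαe : φ α e = 0 := by
        have hmem : φ α ∈ ŝ.A := by rw [hA]; exact Finset.mem_image_of_mem _ hα
        exact Finsupp.notMem_support_iff.mp fun h => he (hŝ.support_subset _ hmem h)
      have herase : (moveExp J e c α).erase e = α := by
        ext b
        by_cases hb : b = e
        · subst hb; rw [Finsupp.erase_same, hαe]
        · rw [Finsupp.erase_ne hb, moveExp_apply_of_ne α hb]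
      have hw : weight J (φ α) = weight J α :=
        Finset.sum_congr rfl fun b hb => hφ α hα b (hJB hb)
      simp only [Function.comp_apply, herase]
      ext b
      by_cases hb : b = e
      · subst hb
        simp [moveExp, hαe, hφαe, hw]
      · simp [moveExp, Finsupp.single_eq_of_ne hb]
    · intro β hβ b hb
      obtain ⟨α, hα, rfl⟩ := Finset.mem_image.mp hβ
      have hαe : α e = 0 :=
        Finsupp.notMem_support_iff.mp fun h => he (hsub.B_subset (hs.support_subset α hα h))
      have herase : (moveExp J e c α).erase e = α := by
        ext b'
        by_cases hb' : b' = e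
        · subst hb'; rw [Finsupp.erase_same, hαe]
        · rw [Finsupp.erase_ne hb', moveExp_apply_of_ne α hb']
      change (φ ((moveExp J e c α).erase e) + Finsupp.single e ((moveExp J e c α) e)) b = _
      rw [herase]
      rcases Finset.mem_insert.mp hb with rfl | hb
      · have hbe : b ∉ (φ α).support := fun h => by
          have hmem : φ α ∈ ŝ.A := by rw [hA]; exact Finset.mem_image_of_mem _ hα
          exact he (hŝ.support_subset _ hmem h)
        simp [Finsupp.notMem_support_iff.mp hbe]
      · have hbe : b ≠ e := fun h => he (hsub.B_subset (h ▸ hb))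
        simp [Finsupp.single_eq_of_ne hbe, hφ α hα b hb, moveExp_apply_of_ne α hbe]

/-- [OURS] Domination persists when the dominating state blows up a stratum which is NOT a stratum
of `s` (the restricted state does not move). -/
theorem Sub.move_right {s ŝ : State} (hs : s.WF) (hsub : Sub s ŝ) {J : Finset ℕ}
    (hJŝ : J ∈ ŝ.Str) (hJ : J ∉ s.Str) {e : ℕ} (he : e ∉ ŝ.B) (c : ℕ) : Sub s (move ŝ J e c) := by
  obtain ⟨φ, hA, hφ⟩ := hsub.exists_map
  refine ⟨hsub.B_subset.trans (Finset.subset_insert _ _), ?_, ?_⟩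
  · intro T hT
    refine mem_moveStrata_iff.mpr (Or.inl ⟨hsub.str_subset hT, fun hJT => hJ ?_⟩)
    exact hs.str_down T hT J hJT
  · refine ⟨moveExp J e c ∘ φ, ?_, ?_⟩
    · change ŝ.A.image (moveExp J e c) = _
      rw [hA, Finset.image_image]
    · intro α hα b hb
      have hbe : b ≠ e := fun h => he (hsub.B_subset (h ▸ hb))
      have _ := hJŝ
      simp [Function.comp_apply, moveExp_apply_of_ne (φ α) hbe, hφ α hα b hb]

/-- [OURS] A fresh name outside any given finite set exists. -/
theorem exists_notMem_finset (F : Finset ℕ) : ∃ e, e ∉ F := by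
  refine ⟨F.sup id + 1, fun h => ?_⟩
  have h2 : id (F.sup id + 1) ≤ F.sup id := Finset.le_sup (f := id) h
  simp only [id] at h2
  omega

/-- [OURS · W5.2 M2-strong] **A win from a dominating state restricts to a win.**  Moves at
strata of `s` are replayed, moves at other strata are skipped; a fresh name of `s` already live in
`ŝ` is reached through a renaming (`WinnableAll.relabel`). -/
theorem WinnableAll.of_sub {m : ℕ} {ŝ : State} (h : WinnableAll m ŝ) :
    ∀ {s : State}, s.WF → ŝ.WF → Sub s ŝ → WinnableAll m s := by
  induction h with
  | done hw => exact fun hs _ hsub => WinnableAll.done (hw.of_sub hs hsub)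
  | @step ŝ J hJ _ ih =>
    intro s hs hŝ hsub
    by_cases hJs : J ∈ s.Str
    · refine WinnableAll.step J (hJ.of_sub hs hsub hJs) fun e he => ?_
      by_cases heŝ : e ∈ ŝ.B
      · -- rename: play with a name fresh for `ŝ`, then swap it with `e`
        obtain ⟨e', he'⟩ := exists_notMem_finset (insert e ŝ.B)
        have he'ŝ : e' ∉ ŝ.B := fun h => he' (Finset.mem_insert_of_mem h)
        have hne : e' ≠ e := fun h => he' (h ▸ Finset.mem_insert_self _ _)
        have hw : WinnableAll m (move s J e' m) :=
          ih e' he'ŝ (WF.move hs J e' m) (WF.move hŝ J e' m) (hsub.move_both hs hŝ hJs he'ŝ m)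
        have hfix : ∀ b ∈ s.B, Equiv.swap e' e b = b := fun b hb =>
          Equiv.swap_apply_of_ne_of_ne (fun h => he'ŝ (hsub.B_subset (h ▸ hb)))
            (fun h => he (h ▸ hb))
        have key := hw.relabel (Equiv.swap e' e)
        rw [relabel_move, relabel_eq_self_of_forall hs _ hfix, Equiv.swap_apply_left,
          Finset.image_congr (g := id) (fun j hj => hfix j (hs.str_subset J hJs (Finset.mem_coe.mp hj))),
          Finset.image_id] at key
        exact key
      · exact ih e heŝ (WF.move hs J e m) (WF.move hŝ J e m) (hsub.move_both hs hŝ hJs heŝ m)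
    · obtain ⟨e, he⟩ := exists_notMem_finset ŝ.B
      exact ih e he hs (WF.move hŝ J e m) (hsub.move_right hs hJ.1 hJs he m)

/-! ## Simplex states -/

/-- [OURS · W5.2 M2-strong] The SIMPLEX state on the same indices and vectors: every subset of
the boundary indices is a stratum (toric model: the affine space `𝔸^B`). -/
def State.simplex (s : State) : State := { s with Str := s.B.powerset }

/-- [OURS] The simplex state of a well-formed state is well-formed. -/
theorem State.WF.simplex {s : State} (hs : s.WF) : s.simplex.WF where
  str_subset _ hT := Finset.mem_powerset.mp hT
  str_down _ hT _ hT' := Finset.mem_powerset.mpr (hT'.trans (Finset.mem_powerset.mp hT))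
  support_subset := hs.support_subset
  nonempty := hs.nonempty

/-- [OURS] The simplex state dominates. -/
theorem Sub.simplex {s : State} (hs : s.WF) : Sub s s.simplex :=
  Sub.of_str_subset fun T hT => Finset.mem_powerset.mpr (hs.str_subset T hT)

/-- [OURS] Unfolding. -/
@[simp] theorem simplex_B (s : State) : s.simplex.B = s.B := rfl

/-- [OURS] Unfolding. -/
@[simp] theorem simplex_Str (s : State) : s.simplex.Str = s.B.powerset := rfl

/-- [OURS · W5.2 M2-strong · Route K, step K6] **The Route-K target follows from its SIMPLEX case**:
it suffices to win, with marking `m` and under all fresh names, from every well-formed state all of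
whose index subsets are strata. -/
theorem routeKTarget_of_simplex {m : ℕ}
    (h : ∀ s : State, s.WF → s.Str = s.B.powerset → WinnableAll m s) : RouteKTarget m :=
  fun s hs => (h s.simplex hs.simplex rfl).of_sub hs hs.simplex (Sub.simplex hs)

end PolyhedraGame

end Summit.ResolutionOfSingularities.ResolutionOfSingularities.Theorems
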